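import Summits.Langlands.Langlands.Theorems.RamifiedCoefficientSeedAdjointLiftingGL3BirthDefs3
import Literature.NumberTheory.GaloisRepresentations.ModPGaloisRepKummerProofs
import Literature.NumberTheory.GaloisRepresentations.SerreWeightShapeProofs
import Literature.RingTheory.Valuation.AlgClosedResidue
import HarnessLib

/-!
# Route `RamifiedCoefficientSeed`, crux `AdjointLiftingGL3` (stmt-Langlands-16779), line `birth`:
# stub `stub_inertiaOrderTeich` (S2b), part (a) — projective inertia order `> 5`

First of the two files of stub S2b of the checked skeleton `Cruxes/AdjointLiftingGL3/Lines/birth.lean`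
(skeleton v5): from the local shape at `p` of the seed (`LocalShapeAt`, stub S2a) to an element of
projective order `> 5` in the image of every residual representation `τ₀` of `ρ₀` — the input
`hord` of Dickson's theorem in stub S3.  Registered sub-goal carried by this file:
`hasProjOrderGtFive_of_localShapeAt`.

* §1 orders in `PGL₂(k)`: the projective order of a diagonal (resp. upper-triangular with distinct
  diagonal entries) element of `GL₂(k)` is the multiplicative order of the ratio of its diagonal
  entries (`orderOf_projMk_eq_orderOf_div`, `orderOf_projMk_of_upperTriangular`); hence the two
  shapes of `LocalShapeAt` (T) give projective order `> 5` as soon as `ω(σ)` (resp. `ω₂(σ)^(p-1)`)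
  has order `> 5` (`five_lt_orderOf_projMk_of_levelOne/Two`);
* §2 the level-`m` fundamental character of a non-archimedean local field takes a value which is a
  PRIMITIVE `(q^m − 1)`-th root of unity of the coefficient field
  (`exists_isPrimitiveRoot_fundamentalCharacter`: surjectivity of the Kummer character of a
  uniformiser, `exists_fundamentalCharacter_apply_eq`, and injectivity of reduction on roots of
  unity of order prime to `p`, `eq_one_of_pow_eq_one_of_sub_one_mem`);
* §3 the place `v ∋ p` of `ℚ`: it exists, `q_v = p`, and `p` is a uniformiser of `ℚ_v`;
* §4 a rank-one `η : Γ_ℚ → GL₁(ℚ̄_p)` has a reduction with the expected entry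
  (`exists_isReductionOf_rank_one`), needed to instantiate `LocalShapeAt`;
* §5 `hasProjOrderGtFive_of_localShapeAt`: with `σ ∈ I_{ℚ_v}` such that `ω(σ)` is a primitive
  `(p−1)`-th (level one) resp. `ω₂(σ)` a primitive `(p²−1)`-th (level two) root of unity, `τ₀(res σ)`
  has projective order `p − 1 ≥ 10` resp. `p + 1 ≥ 12`.

References: Serre, Invent. Math. 15 (1972) §1.3, §1.7; Serre, Duke Math. J. 54 (1987) §2.1–2.2;
Darmon–Diamond–Taylor (1995) §2.1.
-/

set_option linter.dupNamespace false -- `Summit.Langlands.Langlands` is the mandated namespace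

noncomputable section

namespace Summit.Langlands.Langlands.Cruxes.AdjointLiftingGL3.Birth

open scoped MatrixGroups NumberField ValuativeRel
open NumberField IsDedekindDomain Field Filter
open Literature.NumberTheory.GaloisRepresentations Literature.NumberTheory.PAdicHodge
open Literature.NumberTheory.Automorphic
open Literature.NumberTheory.GaloisRepresentations.IsNonarchimedeanLocalField

/-! ## §1. Orders of triangular elements of `PGL₂(k)` -/

section PGL

variable {k : Type*} [Field k]

/-- Conjugation does not change the order in `PGL₂`. [folklore] -/
theorem orderOf_projMk_conj (P g : GL (Fin 2) k) :
    orderOf (Matrix.ProjGenLinGroup.mk (P * g * P⁻¹)) = orderOf (Matrix.ProjGenLinGroup.mk g) := by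
  rw [map_mul, map_mul, map_inv, ← MulAut.conj_apply, MulEquiv.orderOf_eq]

/-- **Projective order of a diagonal element of `GL₂(k)`**: it is the (multiplicative) order of
the ratio of the two diagonal entries (`diag(a, b)^m` is scalar iff `a^m = b^m`). [folklore] -/
theorem orderOf_projMk_eq_orderOf_div (D : GL (Fin 2) k)
    (h01 : (D : Matrix (Fin 2) (Fin 2) k) 0 1 = 0) (h10 : (D : Matrix (Fin 2) (Fin 2) k) 1 0 = 0) :
    orderOf (Matrix.ProjGenLinGroup.mk D) =
      orderOf ((D : Matrix (Fin 2) (Fin 2) k) 0 0 / (D : Matrix (Fin 2) (Fin 2) k) 1 1) := by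
  have hdet : (D : Matrix (Fin 2) (Fin 2) k).det ≠ 0 := by
    rw [← Matrix.GeneralLinearGroup.val_det_apply]; exact (Matrix.GeneralLinearGroup.det D).ne_zero
  set a := (D : Matrix (Fin 2) (Fin 2) k) 0 0 with ha
  set b := (D : Matrix (Fin 2) (Fin 2) k) 1 1 with hb
  have hb0 : b ≠ 0 := by
    intro hb0
    rw [Matrix.det_fin_two, ← ha, ← hb, hb0, h10, mul_zero, mul_zero, sub_zero] at hdet
    exact hdet rfl
  have hD : (D : Matrix (Fin 2) (Fin 2) k) = Matrix.diagonal ![a, b] := by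
    ext i j; fin_cases i <;> fin_cases j <;> simp [ha, hb, h01, h10]
  rw [orderOf_eq_orderOf_iff]
  intro m
  rw [← map_pow, Matrix.ProjGenLinGroup.mk_eq_one,
    Matrix.GeneralLinearGroup.mem_center_iff_val_mem_range_scalar, Units.val_pow_eq_pow_val, hD,
    Matrix.diagonal_pow, div_pow, div_eq_one_iff_eq (pow_ne_zero _ hb0)]
  constructor
  · rintro ⟨c, hc⟩
    rw [Matrix.scalar_apply] at hc
    have h := Matrix.diagonal_injective hc
    have h0 := congrFun h 0
    have h1 := congrFun h 1
    simp only [Pi.pow_apply, Matrix.cons_val_zero, Matrix.cons_val_one, Matrix.cons_val_fin_one]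
      at h0 h1
    rw [← h0, ← h1]
  · intro h
    refine ⟨b ^ m, ?_⟩
    rw [Matrix.scalar_apply]
    congr 1
    ext i
    fin_cases i <;> simp [h]

/-- **Projective order of an upper-triangular element with distinct diagonal entries**: such an
element is diagonalisable (`!![u, e; 0, w] = S · diag(u, w) · S⁻¹`, `S = !![1, e; 0, w − u]`), so its
projective order is the order of `u / w`. [folklore] -/
theorem orderOf_projMk_of_upperTriangular {h : GL (Fin 2) k} {u e w : k}
    (hh : (h : Matrix (Fin 2) (Fin 2) k) = !![u, e; 0, w]) (huw : u ≠ w) :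
    orderOf (Matrix.ProjGenLinGroup.mk h) = orderOf (u / w) := by
  have hdet : (h : Matrix (Fin 2) (Fin 2) k).det ≠ 0 := by
    rw [← Matrix.GeneralLinearGroup.val_det_apply]; exact (Matrix.GeneralLinearGroup.det h).ne_zero
  rw [hh, Matrix.det_fin_two_of, mul_zero, sub_zero] at hdet
  have hS : (!![1, e; 0, w - u] : Matrix (Fin 2) (Fin 2) k).det ≠ 0 := by
    rw [Matrix.det_fin_two_of, mul_zero, sub_zero, one_mul]; exact sub_ne_zero.mpr huw.symm
  have hDdet : (!![u, 0; 0, w] : Matrix (Fin 2) (Fin 2) k).det ≠ 0 := by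
    rw [Matrix.det_fin_two_of, mul_zero, sub_zero]; exact hdet
  set S := Matrix.GeneralLinearGroup.mkOfDetNeZero _ hS with hSdef
  set D := Matrix.GeneralLinearGroup.mkOfDetNeZero _ hDdet with hDdef
  have hconj : h = S * D * S⁻¹ := by
    rw [eq_mul_inv_iff_mul_eq]
    refine Units.ext ?_
    rw [Units.val_mul, Units.val_mul, hh, hSdef, hDdef, Matrix.GeneralLinearGroup.val_mkOfDetNeZero,
      Matrix.GeneralLinearGroup.val_mkOfDetNeZero, Matrix.mul_fin_two, Matrix.mul_fin_two]
    ext i j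
    fin_cases i <;> fin_cases j <;> simp <;> ring
  rw [hconj, orderOf_projMk_conj, orderOf_projMk_eq_orderOf_div D] <;>
    simp [hDdef, Matrix.GeneralLinearGroup.val_mkOfDetNeZero]

/-- **Level one**: if some conjugate of `g` is `a • !![b, c; 0, 1]` with `b` of multiplicative order
`> 5`, then `g` has projective order `> 5` (namely `orderOf b`: the element is diagonalisable with
eigenvalue ratio `b ≠ 1`). [folklore] -/
theorem five_lt_orderOf_projMk_of_levelOne {g P : GL (Fin 2) k} {a b c : k}
    (h : ((P * g * P⁻¹ : GL (Fin 2) k) : Matrix (Fin 2) (Fin 2) k) = a • !![b, c; 0, 1])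
    (hb : 5 < orderOf b) : 5 < orderOf (Matrix.ProjGenLinGroup.mk g) := by
  have hb1 : b ≠ 1 := by rintro rfl; rw [orderOf_one] at hb; omega
  have hdet : ((P * g * P⁻¹ : GL (Fin 2) k) : Matrix (Fin 2) (Fin 2) k).det ≠ 0 := by
    rw [← Matrix.GeneralLinearGroup.val_det_apply]
    exact (Matrix.GeneralLinearGroup.det (P * g * P⁻¹)).ne_zero
  have h' : ((P * g * P⁻¹ : GL (Fin 2) k) : Matrix (Fin 2) (Fin 2) k) = !![a * b, a * c; 0, a] := by
    rw [h]; ext i j; fin_cases i <;> fin_cases j <;> simp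
  rw [h', Matrix.det_fin_two_of, mul_zero, sub_zero] at hdet
  have ha : a ≠ 0 := fun ha => hdet (by rw [ha, mul_zero])
  have huw : a * b ≠ a :=
    fun hab => hb1 (mul_right_injective₀ ha (show a * b = a * 1 by rw [mul_one]; exact hab))
  rw [← orderOf_projMk_conj P g, orderOf_projMk_of_upperTriangular h' huw, mul_div_cancel_left₀ _ ha]
  exact hb

/-- **Level two**: if some conjugate of `g` is `a • diag(x, x^p)` with `x^(p-1)` of multiplicative
order `> 5`, then `g` has projective order `> 5` (the eigenvalue ratio is `x / x^p = (x^(p-1))⁻¹`).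
[folklore] -/
theorem five_lt_orderOf_projMk_of_levelTwo {g P : GL (Fin 2) k} {a x : k} {p : ℕ} (hp : 1 ≤ p)
    (h : ((P * g * P⁻¹ : GL (Fin 2) k) : Matrix (Fin 2) (Fin 2) k) = a • !![x, 0; 0, x ^ p])
    (hx : 5 < orderOf (x ^ (p - 1))) : 5 < orderOf (Matrix.ProjGenLinGroup.mk g) := by
  have hdet : ((P * g * P⁻¹ : GL (Fin 2) k) : Matrix (Fin 2) (Fin 2) k).det ≠ 0 := by
    rw [← Matrix.GeneralLinearGroup.val_det_apply]
    exact (Matrix.GeneralLinearGroup.det (P * g * P⁻¹)).ne_zero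
  have h' : ((P * g * P⁻¹ : GL (Fin 2) k) : Matrix (Fin 2) (Fin 2) k) =
      !![a * x, 0; 0, a * x ^ p] := by
    rw [h]; ext i j; fin_cases i <;> fin_cases j <;> simp
  rw [h', Matrix.det_fin_two_of, zero_mul, sub_zero] at hdet
  have ha : a ≠ 0 := fun ha => hdet (by rw [ha, zero_mul, zero_mul])
  have hx0 : x ≠ 0 := fun hx0 => hdet (by rw [hx0, mul_zero, zero_mul])
  have h01 : ((P * g * P⁻¹ : GL (Fin 2) k) : Matrix (Fin 2) (Fin 2) k) 0 1 = 0 := by rw [h']; simp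
  have h10 : ((P * g * P⁻¹ : GL (Fin 2) k) : Matrix (Fin 2) (Fin 2) k) 1 0 = 0 := by rw [h']; simp
  rw [← orderOf_projMk_conj P g, orderOf_projMk_eq_orderOf_div _ h01 h10, h']
  simp only [Matrix.of_apply, Matrix.cons_val', Matrix.cons_val_zero, Matrix.cons_val_one,
    Matrix.cons_val_fin_one]
  have hxp : x ^ p = x ^ (p - 1) * x := by
    conv_lhs => rw [← Nat.sub_add_cancel hp]
    rw [pow_succ]
  have hratio : a * x / (a * x ^ p) =
      (((Units.mk0 (x ^ (p - 1)) (pow_ne_zero _ hx0))⁻¹ : kˣ) : k) := by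
    rw [mul_div_mul_left _ _ ha, hxp, div_mul_cancel_right₀ hx0, Units.val_inv_eq_inv_val,
      Units.val_mk0]
  rw [hratio, orderOf_units, orderOf_inv, ← orderOf_units, Units.val_mk0]
  exact hx

end PGL

/-! ## §2. Fundamental characters take primitive-root values -/

section Fundamental

variable {F : Type*} [Field F] [ValuativeRel F] [TopologicalSpace F] [IsNonarchimedeanLocalField F]
variable {k : Type*} [Field k]

/-- **The level-`m` fundamental character takes a primitive `(q^m − 1)`-th root of unity as a
value** (`m ≠ 0`): the Kummer character `θ_{q^m-1}` of a uniformiser is onto `μ_{q^m-1}(F̄)`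
(`exists_fundamentalCharacter_apply_eq`), and reduction modulo the proper ideal `ker (ι ∘ mk) ⊇ 𝔓`
is injective on roots of unity of order prime to `p` (`eq_one_of_pow_eq_one_of_sub_one_mem`), so the
image of a primitive root of unity `ζ ∈ F̄` keeps order `q^m − 1` in `k`.  Serre: `θ_{q^m−1}` maps the
tame inertia ONTO `μ_{q^m−1} ≅ 𝔽_{q^m}ˣ`. [cite: SerreInventiones1972, §1.3 Prop. 2 and §1.7] -/
theorem exists_isPrimitiveRoot_fundamentalCharacter {m : ℕ} (hm : m ≠ 0)
    (ι : absIntegers 𝒪[F] F ⧸ absMaximalIdeal F →+* k) (ϖ : 𝒪[F]) (hϖ : Irreducible ϖ) :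
    ∃ τ : absInertia F,
      IsPrimitiveRoot ((fundamentalCharacter F m ι ϖ hϖ τ : kˣ) : k) (residueFieldCard F ^ m - 1) := by
  classical
  have he : 0 < residueFieldCard F ^ m - 1 := residueFieldCard_pow_sub_one_pos F hm
  have hpe : ¬ ringChar 𝓀[F] ∣ residueFieldCard F ^ m - 1 :=
    ModPGaloisRep.InertiaShape.not_ringChar_dvd_pow_sub_one hm
  -- `q^m - 1 ≠ 0` in `F` (as in `exists_isPrimitiveRoot_of_not_dvd`)
  haveI : NeZero (((residueFieldCard F ^ m - 1 : ℕ)) : F) := by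
    refine ⟨fun h0 => hpe ?_⟩
    have hF : ringChar F ∣ residueFieldCard F ^ m - 1 := (ringChar.spec F _).mp h0
    have hpF : ringChar 𝓀[F] ∣ ringChar F := by
      rw [← ringChar.spec 𝓀[F]]
      have h' : ((ringChar F : ℕ) : 𝒪[F]) = 0 := Subtype.ext (by simp)
      rw [← map_natCast (IsLocalRing.residue 𝒪[F]), h', map_zero]
    exact hpF.trans hF
  obtain ⟨ζ, hζ⟩ :=
    HasEnoughRootsOfUnity.exists_primitiveRoot (AlgebraicClosure F) (residueFieldCard F ^ m - 1)
  obtain ⟨τ, Z, hZ, hτ⟩ := exists_fundamentalCharacter_apply_eq F hm ι ϖ hϖ ζ hζ.pow_eq_one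
  refine ⟨τ, ?_⟩
  rw [hτ]
  have hZprim : IsPrimitiveRoot Z (residueFieldCard F ^ m - 1) :=
    IsPrimitiveRoot.of_map_of_injective (f := (absIntegers 𝒪[F] F).val)
      (by rw [← hZ] at hζ; exact hζ) Subtype.val_injective
  set φ : absIntegers 𝒪[F] F →+* k := ι.comp (Ideal.Quotient.mk (absMaximalIdeal F)) with hφ
  change IsPrimitiveRoot (φ Z) (residueFieldCard F ^ m - 1)
  refine IsPrimitiveRoot.mk_of_lt _ he ?_ fun l hl0 hle => ?_
  · rw [← map_pow, hZprim.pow_eq_one, map_one]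
  · intro hl
    have hQ : RingHom.ker φ ≠ ⊤ := RingHom.ker_ne_top φ
    have hmem : Z ^ l - 1 ∈ RingHom.ker φ := by
      rw [RingHom.mem_ker, map_sub, map_pow, hl, map_one, sub_self]
    have hpow : (Z ^ l) ^ (residueFieldCard F ^ m - 1) = 1 := by
      rw [← pow_mul, mul_comm, pow_mul, hZprim.pow_eq_one, one_pow]
    exact hZprim.pow_ne_one_of_pos_of_lt hl0.ne' hle
      (eq_one_of_pow_eq_one_of_sub_one_mem hQ he hpe hpow hmem)

end Fundamental

/-! ## §3. The place `v ∋ p` of `ℚ` -/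

section Place

open Rat.HeightOneSpectrum

/-- The rational prime in a finite place `v` of `ℚ` is its generator `natGenerator v`. [folklore] -/
theorem natGenerator_eq_of_natCast_mem' {p : ℕ} (hp : p.Prime) {v : HeightOneSpectrum (𝓞 ℚ)}
    (hv : ((p : ℕ) : 𝓞 ℚ) ∈ v.asIdeal) : natGenerator v = p := by
  have h : natGenerator v ∣ p := by
    rw [natGenerator_dvd_iff, ← map_natCast (Rat.IsIntegralClosure.intEquiv (𝓞 ℚ)) p]
    exact Ideal.mem_map_of_mem _ hv
  exact (Nat.prime_dvd_prime_iff_eq (prime_natGenerator v) hp).mp h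

/-- `q_v = p` for a place `v ∋ p` of `ℚ`: the residue field of the local field `ℚ_v` has `p`
elements. [folklore] -/
theorem residueFieldCard_adicCompletion_eq_of_mem {p : ℕ} (hp : p.Prime)
    {v : HeightOneSpectrum (𝓞 ℚ)} (hv : ((p : ℕ) : 𝓞 ℚ) ∈ v.asIdeal) :
    residueFieldCard (v.adicCompletion ℚ) = p := by
  rw [residueFieldCard_adicCompletion_eq, Rat.residueCard_eq_natGenerator,
    natGenerator_eq_of_natCast_mem' hp hv]

/-- `p` is a uniformiser of `ℚ_v` for `v ∋ p`. [folklore] -/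
theorem irreducible_natCast_valuativeInteger_of_mem {p : ℕ} (hp : p.Prime)
    {v : HeightOneSpectrum (𝓞 ℚ)} (hv : ((p : ℕ) : 𝓞 ℚ) ∈ v.asIdeal) :
    Irreducible ((p : ℕ) : 𝒪[v.adicCompletion ℚ]) := by
  have h := irreducible_natCast_valuativeInteger_adicCompletion v
  have h2 : ((primesEquiv v : Nat.Primes) : ℕ) = p := natGenerator_eq_of_natCast_mem' hp hv
  rwa [h2] at h

/-- There is a finite place of `ℚ` above every rational prime. [folklore] -/
theorem exists_heightOneSpectrum_natCast_mem (p : ℕ) [Fact p.Prime] :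
    ∃ v : HeightOneSpectrum (𝓞 ℚ), ((p : ℕ) : 𝓞 ℚ) ∈ v.asIdeal := by
  refine ⟨(primesEquiv (R := 𝓞 ℚ)).symm ⟨p, Fact.out⟩, ?_⟩
  set v := (primesEquiv (R := 𝓞 ℚ)).symm ⟨p, Fact.out⟩ with hvdef
  have hv : natGenerator v = p :=
    congrArg Subtype.val ((primesEquiv (R := 𝓞 ℚ)).apply_symm_apply ⟨p, Fact.out⟩)
  have h : ((natGenerator v : ℕ) : ℤ) ∈ v.asIdeal.map (Rat.IsIntegralClosure.intEquiv (𝓞 ℚ)) :=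
    (natGenerator_dvd_iff v).mp dvd_rfl
  rw [hv, ← map_natCast (Rat.IsIntegralClosure.intEquiv (𝓞 ℚ)) p, Ideal.apply_mem_of_equiv_iff] at h
  exact h

end Place

/-! ## §4. Reductions of rank-one representations -/

section RankOne

variable (p : ℕ) [Fact p.Prime]

/-- **A continuous `η : Γ_ℚ → GL₁(ℚ̄_p)` has a reduction `η̄ : Γ_ℚ → GL₁(ℤ̄_p/𝔪)`** (reduction of
an integral model, `exists_integralModel_of_valuationSubring`; in rank one the integral model has
the SAME entry as `η`, `1 × 1` matrices commuting with the change of basis), together with the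
integral entry `x(g) ∈ ℤ̄_p` of `η(g)` and the formula `η̄(g)₀₀ = x(g) mod 𝔪`.
[cite: DarmonDiamondTaylor1995, §2.1, p. 54] -/
theorem exists_isReductionOf_rank_one (η : FramedGaloisRep ℚ (PadicAlgCl p) 1) :
    ∃ (ηb : absoluteGaloisGroup ℚ →* GL (Fin 1) (padicAlgClResidueField p))
      (x : absoluteGaloisGroup ℚ → padicAlgClIntegers p),
      η.IsReductionOf (RingHom.id _) ηb ∧
      (∀ g, ((x g : padicAlgClIntegers p) : PadicAlgCl p) =
        ((η g : GL (Fin 1) (PadicAlgCl p)) : Matrix (Fin 1) (Fin 1) (PadicAlgCl p)) 0 0) ∧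
      ∀ g, ((ηb g : GL (Fin 1) (padicAlgClResidueField p)) :
          Matrix (Fin 1) (Fin 1) (padicAlgClResidueField p)) 0 0 =
        IsLocalRing.residue (padicAlgClIntegers p) (x g) := by
  have hOopen : IsOpen ((padicAlgClIntegers p : ValuationSubring (PadicAlgCl p)) :
      Set (PadicAlgCl p)) :=
    Valued.isOpen_valuationSubring _
  obtain ⟨P, η₀, hη₀⟩ :=
    exists_integralModel_of_valuationSubring (O := padicAlgClIntegers p) hOopen η
  refine ⟨integralReduction (RingHom.id _) η₀,
    fun g => ((η₀ g : GL (Fin 1) (padicAlgClIntegers p)) :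
      Matrix (Fin 1) (Fin 1) (padicAlgClIntegers p)) 0 0,
    ⟨η₀, 1, ⟨P, hη₀⟩, fun g => by simp⟩, fun g => ?_, fun g => ?_⟩
  · have h := congrArg
      (fun M : GL (Fin 1) (PadicAlgCl p) => (M : Matrix (Fin 1) (Fin 1) (PadicAlgCl p)).det) (hη₀ g)
    simp only [Units.val_mul, Matrix.det_units_conj'] at h
    rw [Matrix.det_fin_one, Matrix.det_fin_one] at h
    rw [← h]
    rfl
  · rw [integralReduction_apply_coe]
    rfl

end RankOne

/-! ## §5. Consequence (a) of the local shape: projective inertia order `> 5` -/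

section PartA

/-- **(a) Projective inertia order `> 5`.**  For `p ≥ 11` and every residual `τ₀` of `ρ₀`, some
`τ₀(g)` has projective order `> 5`: at the place `v ∋ p`, by `LocalShapeAt` (T) the image of an
inertia element `σ` is conjugate to `ω(σ)^s (ω(σ) ∗; 0 1)` (level one) or to
`ω(σ)^s diag(ω₂(σ), ω₂(σ)^p)` (level two); choosing `σ` with `ω(σ)` a primitive `(p−1)`-th (resp.
`ω₂(σ)` a primitive `(p²−1)`-th) root of unity (`exists_isPrimitiveRoot_fundamentalCharacter`) gives
projective order `p − 1 ≥ 10` (resp. `p + 1 ≥ 12`).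
[cite: Serre1987, §2.1–2.2] -/
theorem hasProjOrderGtFive_of_localShapeAt :
    ∀ {p : ℕ} [Fact p.Prime], 11 ≤ p →
      ∀ {ρ₀ : FramedGaloisRep ℚ (PadicAlgCl p) 2} {η : FramedGaloisRep ℚ (PadicAlgCl p) 1},
        LocalShapeAt p ρ₀ η →
          ∀ τ₀ : absoluteGaloisGroup ℚ →* GL (Fin 2) (padicAlgClResidueField p),
            ρ₀.IsResidualRepOf (RingHom.id _) τ₀ → HasProjOrderGtFive τ₀ := by
  intro p _ hp ρ₀ η hshape τ₀ hτ₀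
  obtain ⟨v, hv⟩ := exists_heightOneSpectrum_natCast_mem p
  have hpr : p.Prime := Fact.out
  haveI : IsAlgClosed (padicAlgClResidueField p) :=
    Literature.RingTheory.Valuation.isAlgClosed_residueField (padicAlgClIntegers p)
  haveI : CharP (padicAlgClResidueField p) p := charP_padicAlgClResidueField p
  have hq := residueFieldCard_adicCompletion_eq_of_mem hpr hv
  have hirr := irreducible_natCast_valuativeInteger_of_mem hpr hv
  obtain ⟨ιr⟩ := nonempty_ringHom_residue (k := padicAlgClResidueField p) p (v.adicCompletion ℚ) hq
  obtain ⟨ηb, x, hηb, -, -⟩ := exists_isReductionOf_rank_one p η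
  obtain ⟨s, hT⟩ := (hshape v hv τ₀ ηb hτ₀ hηb ιr _ hirr).2
  rcases hT with ⟨P, hP, -⟩ | ⟨P, hP⟩
  · -- level one: projective order `p - 1`
    obtain ⟨τ, hτ⟩ := exists_isPrimitiveRoot_fundamentalCharacter
      (F := v.adicCompletion ℚ) one_ne_zero ιr _ hirr
    rw [pow_one, hq] at hτ
    obtain ⟨c, hc⟩ := hP τ
    have hord : 5 < orderOf ((fundamentalCharacter (v.adicCompletion ℚ) 1 ιr _ hirr τ :
        (padicAlgClResidueField p)ˣ) : padicAlgClResidueField p) := by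
      rw [← hτ.eq_orderOf]
      omega
    exact ⟨_, five_lt_orderOf_projMk_of_levelOne hc hord⟩
  · -- level two: projective order `p + 1`
    obtain ⟨τ, hτ⟩ := exists_isPrimitiveRoot_fundamentalCharacter
      (F := v.adicCompletion ℚ) two_ne_zero ιr _ hirr
    rw [hq] at hτ
    have hP' := hP τ
    simp only [Units.val_pow_eq_pow_val] at hP'
    have hfac : p ^ 2 - 1 = (p - 1) * (p + 1) := by
      have h := Nat.sq_sub_sq p 1
      rw [one_pow] at h
      rw [h, mul_comm]
    have hpos : 0 < p ^ 2 - 1 := by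
      have := residueFieldCard_pow_sub_one_pos (v.adicCompletion ℚ) two_ne_zero
      rwa [hq] at this
    have h2 := hτ.pow hpos hfac
    have hord : 5 < orderOf (((fundamentalCharacter (v.adicCompletion ℚ) 2 ιr _ hirr τ :
        (padicAlgClResidueField p)ˣ) : padicAlgClResidueField p) ^ (p - 1)) := by
      rw [← h2.eq_orderOf]
      omega
    exact ⟨_, five_lt_orderOf_projMk_of_levelTwo hpr.one_lt.le hP' hord⟩

end PartA

end Summit.Langlands.Langlands.Cruxes.AdjointLiftingGL3.Birth

end
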